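import Literature.ModelTheory.ExponentialFields.NewtonExpSystems
import Literature.ModelTheory.ExponentialFields.LastRootConjectureProofs
import HarnessLib

/-!
# The Newton sentences `NK_F` of a square system of exponential terms, and their semantics

Family `periods` (periods.S27), topic `Literature/ModelTheory/ExponentialFields`: node (B7′) of the
decomposition of the conditional half of Macintyre–Wilkie's theorem
(`Literature.ModelTheory.ExponentialFields.macintyreWilkie_existential_of_schanuelProperty`).

Macintyre–Wilkie's theory proves, for every square system `F` of exponential polynomials, a
Newton approximation statement (Macintyre–Wilkie 1996, Thm. 4.1; Jones–Servi 2011, Lemma 3.5: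
"`T ⊨ ∀x̄₀ (‖x̄₀‖ < N, ‖F(x̄₀)‖ < θ⁻¹, |JF(x̄₀)| > N⁻¹ ⇒ ∃x̄ ∈ B(x̄₀, N⁻¹) ∩ V^{reg}(F))`").  In
this decomposition the corresponding statements are not *derived* inside a weak theory but
*adjoined* to it as a scheme of sentences true in `ℝ_exp` (their truth being the real theorem
`NewtonExp.exists_zero_of_newtonHyp`, `NewtonExpSystems.lean`).  This file writes down, for a
square system `F = (F₁, …, Fₙ)` of parameter-free exponential terms together with square arrays
of terms `G i j` (for the Jacobian entries `∂ⱼFᵢ`) and `H i j k` (for `∂ₖ∂ⱼFᵢ`), ONE first-order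
sentence

  `NK_{F,G,H} := ∀ q̄ B β δ ν, Hyp(q̄, B, β, δ, ν) → ∃ x̄, F₁(x̄) = ⋯ = Fₙ(x̄) = 0`,

where `Hyp` is the conjunction of the polynomial (in)equalities of
`exists_zero_of_newtonHyp(_of_terms)`: `0 ≤ β, δ, ν`, `B · G(q̄) = 1`, `|Bᵢⱼ| ≤ β`, `|Fᵢ(q̄)| ≤ δ`,
`|qᵢ| + 2nβδ ≤ ν`, `4 · Lip_H(ν) · (nβ) · (nβδ) ≤ 1`, with `Lip_H(ν)` the sum of the majorant
terms `NewtonExp.majTerm` (`NewtonExpSystems.lean`) of the `H i j k` — and proves its **semantics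
in every lawful structure on an ordered field** (`realize_newtonSentence_iff`), so that it can be
(i) shown true in `ℝ` from the real theorem (done here for `G, H` the formal partial derivatives
`RealExpModel.termPDeriv`: `real_models_newtonSentence_pd`) and (ii) *used* inside the models
of weak theories (`NewtonTransfer.lean`, to come).  Keeping `G, H` as parameters lets flat
exponential polynomials supply their derivatives computed on the monomial codes (so that the
Gödel numbers of the sentences are computable without differentiating terms symbolically).

The conclusion of `NK` is only the existence of a common zero — weaker than the real theorem
(zero within `2nβδ` of `q̄`, invertible Jacobian) and than the printed `B(x̄₀, N⁻¹) ∩ V^{reg}(F)`;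
this is all the decision procedure uses downstream (a zero of an auxiliary square system in an
arbitrary model, from which the vanishing of the target exponential polynomial follows by an
algebraic identity), so the scheme is kept minimal.

## Contents (all proved; definitions are syntax)

* generic realization lemmas for the syntax helpers `ExpPolyCode.natTerm`, `ExpPolyCode.sumTerm`,
  `ExpPolyCode.andL` of `LastRootConjectureProofs.lean` in any lawful structure (there: `ℝ` only),
  and `realize_majTerm_lawful` for `NewtonExp.majTerm` (there: `ℝ` only), via
  `NewtonExp.majEval E ν t` (the structural majorant evaluated with an arbitrary `E`);
* the encoding at depth `dep n = n + n·n + 3` (variables `q̄`, `B`, `β`, `δ`, `ν`): `hypB F G H`,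
  and at depth `dep n + n`: `zeroB F`; `NewtonExp.newtonSentence F G H`;
* `NewtonExp.NewtonHyp` (the semantic hypothesis) and `NewtonExp.realize_newtonSentence_iff`;
* the bridge to `NewtonExpSystems.lean` over `ℝ`: `pdTerms`, `pd2Terms`, `jacM_pdTerms_real`,
  `majEval_real`, `lipM_pd2Terms_real`, and **`real_models_newtonSentence_pd : ℝ ⊨ NK_F`** for
  `G, H` the formal derivatives.

## References

* A. Macintyre, A. J. Wilkie, *On the decidability of the real exponential field* (1996), Thm. 4.1.
* G. O. Jones, T. Servi, *On the decidability of the real field with a generic power function*,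
  J. Symb. Log. 76 (2011), Lemma 3.5.
-/

noncomputable section

open FirstOrder FirstOrder.Language FirstOrder.Language.Structure
open scoped BigOperators Matrix

namespace Literature.ModelTheory.ExponentialFields

namespace NewtonExp

open RealExpModel ExpPolyCode

variable {M : Type*} [Language.orderedExpRing.Structure M] [Field M] [LinearOrder M]
  [RealExpModel.LawfulStructure M]

/-! ### Generic semantics of the syntax helpers -/

/-- Numerals realize to the corresponding natural numbers in any lawful structure
(`ExpPolyCode.realize_natTerm` is the case `ℝ`). [folklore] -/
@[simp] theorem realize_natTerm_lawful {α : Type*} (v : α → M) :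
    ∀ k : ℕ, (natTerm k : Language.orderedExpRing.Term α).realize v = k
  | 0 => by simp [natTerm]
  | k + 1 => by simp [natTerm, realize_natTerm_lawful v k]

/-- Sum terms realize to sums in any lawful structure. [folklore] -/
@[simp] theorem realize_sumTerm_lawful {α : Type*} (v : α → M) :
    ∀ l : List (Language.orderedExpRing.Term α),
      (sumTerm l).realize v = (l.map fun t => t.realize v).sum
  | [] => by simp [sumTerm]
  | t :: l => by simp [sumTerm, realize_sumTerm_lawful v l]

omit [Field M] [LinearOrder M] [RealExpModel.LawfulStructure M] in
/-- `andL l` holds iff every member of `l` holds, in any structure. [folklore] -/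
theorem realize_andL_iff {k : ℕ} (v : Empty → M) (xs : Fin k → M) :
    ∀ l : List (Language.orderedExpRing.BoundedFormula Empty k),
      (andL l).Realize v xs ↔ ∀ φ ∈ l, φ.Realize v xs
  | [] => by simp [andL]
  | φ :: l => by
    rw [andL, BoundedFormula.realize_inf, realize_andL_iff v xs l]
    simp

omit [Field M] [LinearOrder M] [RealExpModel.LawfulStructure M] in
/-- `andL (l.map f)` holds iff `f i` holds for every `i ∈ l`, in any structure. [folklore] -/
theorem realize_andL_map_iff {k : ℕ} (v : Empty → M) (xs : Fin k → M) {ι : Type*} (l : List ι)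
    (f : ι → Language.orderedExpRing.BoundedFormula Empty k) :
    (andL (l.map f)).Realize v xs ↔ ∀ i ∈ l, (f i).Realize v xs := by
  rw [realize_andL_iff]
  simp

/-! ### The structural majorant with an arbitrary exponential -/

/-- The structural majorant of a parameter-free term, evaluated in a field `M` with a map `E`
(same recursion as `NewtonExp.majFun`, which is the case `M = ℝ`, `E = Real.exp`). [folklore] -/
def majEval {n : ℕ} (E : M → M) (ν : M) : Language.orderedExpRing.Term (Empty ⊕ Fin n) → M
  | var _ => ν
  | func expRingFunc.add ts => (fun i => majEval E ν (ts i)) 0 + (fun i => majEval E ν (ts i)) 1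
  | func expRingFunc.mul ts => (fun i => majEval E ν (ts i)) 0 * (fun i => majEval E ν (ts i)) 1
  | func expRingFunc.neg ts => (fun i => majEval E ν (ts i)) 0
  | func expRingFunc.zero _ => 0
  | func expRingFunc.one _ => 1
  | func expRingFunc.exp ts => E ((fun i => majEval E ν (ts i)) 0)

/-- The interpretation of the `exp` symbol as a function. [folklore] -/
def expM (M : Type*) [Language.orderedExpRing.Structure M] (a : M) : M :=
  funMap (L := Language.orderedExpRing) expRingFunc.exp ![a]

omit [Field M] [LinearOrder M] [RealExpModel.LawfulStructure M] in
/-- `funMap exp v = expM (v 0)`. [folklore] -/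
theorem funMap_exp_eq_expM (v : Fin 1 → M) :
    funMap (L := Language.orderedExpRing) expRingFunc.exp v = expM M (v 0) :=
  congrArg _ (by ext i; fin_cases i; rfl)

/-- The majorant term `NewtonExp.majTerm` realizes, in any lawful structure, to the majorant
value `majEval` at the value of `w` (generalisation of `NewtonExp.realize_majTerm`, the case
`ℝ`). [folklore] -/
theorem realize_majTerm_lawful {n : ℕ} {β : Type} (w : Language.orderedExpRing.Term β) (v : β → M) :
    ∀ t : Language.orderedExpRing.Term (Empty ⊕ Fin n),
      (majTerm w t).realize v = majEval (expM M) (w.realize v) t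
  | var _ => rfl
  | func expRingFunc.add ts => by
    simp only [majTerm, majEval, ExpTerm.realize_add, realize_majTerm_lawful w v (ts 0),
      realize_majTerm_lawful w v (ts 1)]
  | func expRingFunc.mul ts => by
    simp only [majTerm, majEval, ExpTerm.realize_mul, realize_majTerm_lawful w v (ts 0),
      realize_majTerm_lawful w v (ts 1)]
  | func expRingFunc.neg ts => by
    simp only [majTerm, majEval, realize_majTerm_lawful w v (ts 0)]
  | func expRingFunc.zero _ => by simp [majTerm, majEval]
  | func expRingFunc.one _ => by simp [majTerm, majEval]
  | func expRingFunc.exp ts => by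
    simp only [majTerm, majEval, ExpTerm.realize_termExp_eq_funMap, realize_majTerm_lawful w v (ts 0),
      funMap_exp_eq_expM]
    rfl

/-! ### The encoding -/

section Encoding

variable {n : ℕ} (F : Fin n → Language.orderedExpRing.Term (Empty ⊕ Fin n))
  (G : Fin n → Fin n → Language.orderedExpRing.Term (Empty ⊕ Fin n))
  (H : Fin n → Fin n → Fin n → Language.orderedExpRing.Term (Empty ⊕ Fin n))

variable (n) in
/-- the depth of the universal block: `q̄` (`n`), `B` (`n·n`), `β, δ, ν` (`3`) [folklore] -/
abbrev dep : ℕ := n + n * n + 3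

variable (n) in
/-- index of `q_i` [folklore] -/
def qIdx (i : Fin n) : Fin (dep n) := Fin.castAdd 3 (Fin.castAdd (n * n) i)

variable (n) in
/-- index of `B i j` [folklore] -/
def bIdx (i j : Fin n) : Fin (dep n) := Fin.castAdd 3 (Fin.natAdd n (finProdFinEquiv (i, j)))

variable (n) in
/-- indices of `β`, `δ`, `ν` [folklore] -/
def cIdx (l : Fin 3) : Fin (dep n) := Fin.natAdd (n + n * n) l

variable (n) in
/-- the variable term of `q_i` [folklore] -/
def qv (i : Fin n) : Language.orderedExpRing.Term (Empty ⊕ Fin (dep n)) := var (Sum.inr (qIdx n i))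
variable (n) in
/-- the variable term of `B i j` [folklore] -/
def bv (i j : Fin n) : Language.orderedExpRing.Term (Empty ⊕ Fin (dep n)) := var (Sum.inr (bIdx n i j))
variable (n) in
/-- the variable term of `β` [folklore] -/
def βv : Language.orderedExpRing.Term (Empty ⊕ Fin (dep n)) := var (Sum.inr (cIdx n 0))
variable (n) in
/-- the variable term of `δ` [folklore] -/
def δv : Language.orderedExpRing.Term (Empty ⊕ Fin (dep n)) := var (Sum.inr (cIdx n 1))
variable (n) in
/-- the variable term of `ν` [folklore] -/
def νv : Language.orderedExpRing.Term (Empty ⊕ Fin (dep n)) := var (Sum.inr (cIdx n 2))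

/-- `qIdx` is injective. [folklore] -/
theorem qIdx_injective : Function.Injective (qIdx n) :=
  (Fin.castAdd_injective _ _).comp (Fin.castAdd_injective _ _)

/-- the term `F_i(q̄)` at depth `dep n` [folklore] -/
def FqB (i : Fin n) : Language.orderedExpRing.Term (Empty ⊕ Fin (dep n)) :=
  (F i).relabel (Sum.map _root_.id (qIdx n))

/-- the term `G j k (q̄)` (Jacobian entry) at depth `dep n` [folklore] -/
def GqB (j k : Fin n) : Language.orderedExpRing.Term (Empty ⊕ Fin (dep n)) :=
  (G j k).relabel (Sum.map _root_.id (qIdx n))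

/-- the Lipschitz-constant term `Lip_H(ν) = Σ_{i,j,k} maj(H i j k)(ν)` at depth `dep n` [folklore] -/
def lipB : Language.orderedExpRing.Term (Empty ⊕ Fin (dep n)) :=
  sumTerm ((List.finRange n).map fun i => sumTerm ((List.finRange n).map fun j =>
    sumTerm ((List.finRange n).map fun k => majTerm (νv n) (H i j k))))

/-- `|t| ≤ s` as the formula `-s ≤ t ∧ t ≤ s` [folklore] -/
def absLeB {d : ℕ} (t s : Language.orderedExpRing.Term (Empty ⊕ Fin d)) :
    Language.orderedExpRing.BoundedFormula Empty d :=
  ((-s).le t) ⊓ (t.le s)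

/-- **the hypothesis `Hyp(q̄, B, β, δ, ν)`** of the Newton sentence, at depth `dep n` [folklore] -/
def hypB : Language.orderedExpRing.BoundedFormula Empty (dep n) :=
  andL [
    (0 : Language.orderedExpRing.Term _).le (βv n),
    (0 : Language.orderedExpRing.Term _).le (δv n),
    (0 : Language.orderedExpRing.Term _).le (νv n),
    -- `B · G(q̄) = 1`
    andL ((List.finRange n).map fun i => andL ((List.finRange n).map fun k =>
      Term.bdEqual (sumTerm ((List.finRange n).map fun j => bv n i j * GqB G j k))
        (if i = k then 1 else 0))),
    -- `|B i j| ≤ β`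
    andL ((List.finRange n).map fun i => andL ((List.finRange n).map fun j =>
      absLeB (bv n i j) (βv n))),
    -- `|F_i(q̄)| ≤ δ`
    andL ((List.finRange n).map fun i => absLeB (FqB F i) (δv n)),
    -- `|q_i| + 2 n β δ ≤ ν`, as `|q_i| ≤ ν - 2 n β δ`
    andL ((List.finRange n).map fun i =>
      absLeB (qv n i) (νv n + -(natTerm 2 * (natTerm n * βv n * δv n)))),
    -- `4 · Lip(ν) · (n β) · (n β δ) ≤ 1`
    (natTerm 4 * lipB H * (natTerm n * βv n) * (natTerm n * βv n * δv n)).le 1 ]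

/-- index of `x_i` at depth `dep n + n` [folklore] -/
def xIdx (i : Fin n) : Fin (dep n + n) := Fin.natAdd (dep n) i

/-- the term `F_i(x̄)` at depth `dep n + n` [folklore] -/
def FxB (i : Fin n) : Language.orderedExpRing.Term (Empty ⊕ Fin (dep n + n)) :=
  (F i).relabel (Sum.map _root_.id (xIdx (n := n)))

/-- "`x̄` is a common zero of `F`", at depth `dep n + n` [folklore] -/
def zeroB : Language.orderedExpRing.BoundedFormula Empty (dep n + n) :=
  andL ((List.finRange n).map fun i => Term.bdEqual (FxB F i) 0)

/-- `k` existential quantifiers in front of a formula at depth `d + k` [folklore] -/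
def exN {d : ℕ} : (k : ℕ) → Language.orderedExpRing.BoundedFormula Empty (d + k) →
    Language.orderedExpRing.BoundedFormula Empty d
  | 0, φ => φ
  | k + 1, φ => exN k φ.ex

/-- **The Newton sentence `NK_{F,G,H}`**: `∀ q̄ B β δ ν, Hyp → ∃ x̄, F(x̄) = 0`. [cite: JonesServi2011, Lemma 3.5 (shape of the statement)] -/
def newtonSentence : Language.orderedExpRing.Sentence :=
  (hypB F G H ⟹ exN n (zeroB F)).alls

end Encoding

/-! ### Semantics -/

section Semantics

variable {n : ℕ} (F : Fin n → Language.orderedExpRing.Term (Empty ⊕ Fin n))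
  (G : Fin n → Fin n → Language.orderedExpRing.Term (Empty ⊕ Fin n))
  (H : Fin n → Fin n → Fin n → Language.orderedExpRing.Term (Empty ⊕ Fin n))

/-- The semantic Jacobian given by the terms `G` at `q` in `M` (shape of `NewtonExp.jacFun`). [folklore] -/
def jacM (q : Fin n → M) : Matrix (Fin n) (Fin n) M :=
  Matrix.of fun i j => (G i j).realize (Sum.elim (Empty.elim : Empty → M) q)

/-- The semantic Lipschitz constant `Lip_H(ν)` in `M`. [folklore] -/
def lipM (ν : M) : M :=
  ∑ i, ∑ j, ∑ k, majEval (expM M) ν (H i j k)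

/-- **The semantic Newton hypothesis** `Hyp(q̄, B, β, δ, ν)` in an ordered field `M` — the
hypothesis list of `NewtonExp.exists_zero_of_newtonHyp` (for `G, H` the formal derivatives) and
of `NewtonExp.exists_zero_of_newtonHyp_of_terms`. [folklore] -/
structure NewtonHyp (q : Fin n → M) (B : Matrix (Fin n) (Fin n) M) (β δ ν : M) : Prop where
  /-- `0 ≤ β` -/ hβ₀ : 0 ≤ β
  /-- `0 ≤ δ` -/ hδ₀ : 0 ≤ δ
  /-- `0 ≤ ν` -/ hν₀ : 0 ≤ ν
  /-- `B · G(q̄) = 1` -/ hB : B * jacM G q = 1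
  /-- `|B i j| ≤ β` -/ hβ : ∀ i j, |B i j| ≤ β
  /-- `|F_i(q̄)| ≤ δ` -/ hδ : ∀ i, |(F i).realize (Sum.elim (Empty.elim : Empty → M) q)| ≤ δ
  /-- `|q_i| + 2 n β δ ≤ ν` -/ hν : ∀ i, |q i| + 2 * (n * β * δ) ≤ ν
  /-- `4 · Lip(ν) · (nβ) · (nβδ) ≤ 1` -/ hsmall : 4 * lipM H ν * (n * β) * (n * β * δ) ≤ 1

variable {F G H}

/-- the components of a valuation of the universal block [folklore] -/
def qOf (xs : Fin (dep n) → M) : Fin n → M := fun i => xs (qIdx n i)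
/-- the matrix component of a valuation of the universal block [folklore] -/
def bOf (xs : Fin (dep n) → M) : Matrix (Fin n) (Fin n) M := Matrix.of fun i j => xs (bIdx n i j)

/-- the valuation of the universal block determined by `(q̄, B, β, δ, ν)` [folklore] -/
def valOf (q : Fin n → M) (B : Matrix (Fin n) (Fin n) M) (β δ ν : M) : Fin (dep n) → M :=
  Fin.append (Fin.append q fun l => B (finProdFinEquiv.symm l).1 (finProdFinEquiv.symm l).2) ![β, δ, ν]

omit [Language.orderedExpRing.Structure M] [Field M] [LinearOrder M] [RealExpModel.LawfulStructure M] in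
/-- `valOf` at `q_i`. [folklore] -/
@[simp] theorem valOf_qIdx (q : Fin n → M) (B : Matrix (Fin n) (Fin n) M) (β δ ν : M) (i : Fin n) :
    valOf q B β δ ν (qIdx n i) = q i := by
  simp only [valOf, qIdx, Fin.append_left]

omit [Language.orderedExpRing.Structure M] [Field M] [LinearOrder M] [RealExpModel.LawfulStructure M] in
/-- `valOf` at `B i j`. [folklore] -/
@[simp] theorem valOf_bIdx (q : Fin n → M) (B : Matrix (Fin n) (Fin n) M) (β δ ν : M) (i j : Fin n) :
    valOf q B β δ ν (bIdx n i j) = B i j := by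
  simp only [valOf, bIdx, Fin.append_left, Fin.append_right, Equiv.symm_apply_apply]

omit [Language.orderedExpRing.Structure M] [Field M] [LinearOrder M] [RealExpModel.LawfulStructure M] in
/-- `valOf` at `β, δ, ν`. [folklore] -/
@[simp] theorem valOf_cIdx (q : Fin n → M) (B : Matrix (Fin n) (Fin n) M) (β δ ν : M) (l : Fin 3) :
    valOf q B β δ ν (cIdx n l) = ![β, δ, ν] l := by
  simp only [valOf, cIdx, Fin.append_right]

omit [Language.orderedExpRing.Structure M] [Field M] [LinearOrder M] [RealExpModel.LawfulStructure M] in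
/-- Every valuation of the universal block is a `valOf`. [folklore] -/
theorem valOf_eq (xs : Fin (dep n) → M) :
    valOf (qOf xs) (bOf xs) (xs (cIdx n 0)) (xs (cIdx n 1)) (xs (cIdx n 2)) = xs := by
  funext l
  simp only [valOf]
  refine Fin.addCases (fun l' => ?_) (fun l' => ?_) l
  · rw [Fin.append_left]
    refine Fin.addCases (fun i => ?_) (fun m => ?_) l'
    · rw [Fin.append_left]; rfl
    · rw [Fin.append_right]
      simp only [bOf, bIdx, Matrix.of_apply, Prod.mk.eta, Equiv.apply_symm_apply]
  · rw [Fin.append_right]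
    fin_cases l' <;> rfl

omit [Field M] [LinearOrder M] [RealExpModel.LawfulStructure M] in
/-- Realization of `F_i(q̄)`. [folklore] -/
theorem realize_FqB (v : Empty → M) (xs : Fin (dep n) → M) (i : Fin n) :
    (FqB F i).realize (Sum.elim v xs) = (F i).realize (Sum.elim (Empty.elim : Empty → M) (qOf xs)) := by
  rw [FqB, Term.realize_relabel]
  congr 1
  funext a; rcases a with e | j
  · exact e.elim
  · rfl

omit [Field M] [LinearOrder M] [RealExpModel.LawfulStructure M] in
/-- Realization of `G j k (q̄)`: the Jacobian entry. [folklore] -/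
theorem realize_GqB (v : Empty → M) (xs : Fin (dep n) → M) (j k : Fin n) :
    (GqB G j k).realize (Sum.elim v xs) = jacM G (qOf xs) j k := by
  rw [GqB, Term.realize_relabel, jacM, Matrix.of_apply]
  congr 1
  funext a; rcases a with e | i
  · exact e.elim
  · rfl

/-- Realization of `Lip_H(ν)`. [folklore] -/
theorem realize_lipB (v : Empty → M) (xs : Fin (dep n) → M) :
    (lipB H).realize (Sum.elim v xs) = lipM H (xs (cIdx n 2)) := by
  simp only [lipB, lipM, realize_sumTerm_lawful, List.map_map, Function.comp_def, realize_majTerm_lawful,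
    Fin.sum_univ_def]
  rfl

/-- Realization of `t₁ ≤ t₂` (as a bounded formula) in a lawful structure. [folklore] -/
theorem realize_termLe_lawful {α : Type*} {d : ℕ} (v : α → M) (xs : Fin d → M)
    (t₁ t₂ : Language.orderedExpRing.Term (α ⊕ Fin d)) :
    (t₁.le t₂).Realize v xs ↔ t₁.realize (Sum.elim v xs) ≤ t₂.realize (Sum.elim v xs) := by
  rw [Term.le, BoundedFormula.realize_rel₂]
  exact (RealExpModel.LawfulStructure.relMap_le _).trans (by simp)

/-- Realization of `absLeB t s`: `|t| ≤ s`. [folklore] -/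
theorem realize_absLeB {d : ℕ} (v : Empty → M) (xs : Fin d → M)
    (t s : Language.orderedExpRing.Term (Empty ⊕ Fin d)) [IsStrictOrderedRing M] :
    (absLeB t s).Realize v xs ↔ |t.realize (Sum.elim v xs)| ≤ s.realize (Sum.elim v xs) := by
  rw [absLeB, BoundedFormula.realize_inf]
  simp only [realize_termLe_lawful, ExpTerm.realize_neg, abs_le]

variable [IsStrictOrderedRing M]

/-- **Semantics of `hypB`**: the valuation `xs` of `(q̄, B, β, δ, ν)` satisfies `Hyp_F`. [folklore] -/
theorem realize_hypB (v : Empty → M) (xs : Fin (dep n) → M) :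
    (hypB F G H).Realize v xs ↔
      NewtonHyp F G H (qOf xs) (bOf xs) (xs (cIdx n 0)) (xs (cIdx n 1)) (xs (cIdx n 2)) := by
  have hq : ∀ i, (qv n i).realize (Sum.elim v xs) = qOf xs i := fun i => rfl
  have hb : ∀ i j, (bv n i j).realize (Sum.elim v xs) = bOf xs i j := fun i j => rfl
  have hβ : (βv n).realize (Sum.elim v xs) = xs (cIdx n 0) := rfl
  have hδ : (δv n).realize (Sum.elim v xs) = xs (cIdx n 1) := rfl
  have hν : (νv n).realize (Sum.elim v xs) = xs (cIdx n 2) := rfl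
  have hinv : (andL ((List.finRange n).map fun i => andL ((List.finRange n).map fun k =>
      Term.bdEqual (sumTerm ((List.finRange n).map fun j => bv n i j * GqB G j k))
        (if i = k then 1 else 0)))).Realize v xs ↔ bOf xs * jacM G (qOf xs) = 1 := by
    rw [realize_andL_map_iff, ← Matrix.ext_iff]
    simp only [List.mem_finRange, true_implies, realize_andL_map_iff, BoundedFormula.realize_bdEqual,
      realize_sumTerm_lawful, List.map_map, Function.comp_def, ExpTerm.realize_mul, hb, realize_GqB,
      Matrix.mul_apply, Fin.sum_univ_def, Matrix.one_apply]
    constructor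
    · intro h i k; rw [h i k]; split_ifs <;> simp
    · intro h i k; rw [h i k]; split_ifs <;> simp
  rw [hypB, realize_andL_iff]
  simp only [List.mem_cons, List.not_mem_nil, or_false, forall_eq_or_imp, forall_eq]
  rw [hinv]
  simp only [realize_andL_map_iff, List.mem_finRange, true_implies, realize_absLeB, realize_termLe_lawful,
    ExpTerm.realize_zero, ExpTerm.realize_add, ExpTerm.realize_neg, ExpTerm.realize_mul, ExpTerm.realize_one,
    realize_natTerm_lawful, hq, hb, hβ, hδ, hν, realize_FqB, realize_lipB]
  constructor
  · rintro ⟨h0, h1, h2, h3, h4, h5, h6, h7⟩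
    refine ⟨h0, h1, h2, h3, h4, h5, fun i => ?_, ?_⟩
    · have := h6 i; push_cast at this ⊢; linarith
    · push_cast at h7 ⊢; linarith
  · rintro ⟨h0, h1, h2, h3, h4, h5, h6, h7⟩
    refine ⟨h0, h1, h2, h3, h4, h5, fun i => ?_, ?_⟩
    · have := h6 i; push_cast at this ⊢; linarith
    · push_cast at h7 ⊢; linarith

omit [Field M] [LinearOrder M] [RealExpModel.LawfulStructure M] [IsStrictOrderedRing M] in
/-- Realization of `F_i(x̄)` at depth `dep n + n`. [folklore] -/
theorem realize_FxB (v : Empty → M) (ys : Fin (dep n + n) → M) (i : Fin n) :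
    (FxB F i).realize (Sum.elim v ys) =
      (F i).realize (Sum.elim (Empty.elim : Empty → M) fun j => ys (xIdx j)) := by
  rw [FxB, Term.realize_relabel]
  congr 1
  funext a; rcases a with e | j
  · exact e.elim
  · rfl

omit [IsStrictOrderedRing M] in
/-- Semantics of `zeroB`. [folklore] -/
theorem realize_zeroB (v : Empty → M) (ys : Fin (dep n + n) → M) :
    (zeroB F).Realize v ys ↔
      ∀ i, (F i).realize (Sum.elim (Empty.elim : Empty → M) fun j => ys (xIdx j)) = 0 := by
  rw [zeroB, realize_andL_map_iff]
  simp only [List.mem_finRange, true_implies, BoundedFormula.realize_bdEqual, realize_FxB,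
    ExpTerm.realize_zero]

omit [Field M] [LinearOrder M] [RealExpModel.LawfulStructure M] [IsStrictOrderedRing M] in
/-- Semantics of the existential block `exN`. [folklore] -/
theorem realize_exN {d : ℕ} (v : Empty → M) :
    ∀ (k : ℕ) (φ : Language.orderedExpRing.BoundedFormula Empty (d + k)) (xs : Fin d → M),
      (exN k φ).Realize v xs ↔ ∃ ys : Fin k → M, φ.Realize v (Fin.append xs ys)
  | 0, φ, xs => by
    simp only [exN]
    constructor
    · intro h; exact ⟨Fin.elim0, by simpa [Fin.append_elim0] using h⟩
    · rintro ⟨ys, h⟩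
      rwa [Subsingleton.elim ys Fin.elim0, Fin.append_elim0] at h
  | k + 1, φ, xs => by
    rw [exN, realize_exN v k φ.ex xs]
    simp only [BoundedFormula.realize_ex]
    constructor
    · rintro ⟨ys, y, h⟩
      refine ⟨Fin.snoc ys y, ?_⟩
      rwa [Fin.append_snoc]
    · rintro ⟨ys, h⟩
      refine ⟨Fin.init ys, ys (Fin.last k), ?_⟩
      rwa [← Fin.append_snoc, Fin.snoc_init_self]

/-- **Semantics of the Newton sentence** in a lawful structure on an ordered field:
`M ⊨ NK_F` iff for all `(q̄, B, β, δ, ν)` satisfying `Hyp_F`, the system `F` has a common zero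
in `Mⁿ`. [cite: JonesServi2011, Lemma 3.5 (shape of the statement)] -/
theorem realize_newtonSentence_iff :
    M ⊨ newtonSentence F G H ↔
      ∀ (q : Fin n → M) (B : Matrix (Fin n) (Fin n) M) (β δ ν : M), NewtonHyp F G H q B β δ ν →
        ∃ x : Fin n → M, ∀ i, (F i).realize (Sum.elim (Empty.elim : Empty → M) x) = 0 := by
  unfold newtonSentence Sentence.Realize
  rw [BoundedFormula.realize_alls]
  simp only [BoundedFormula.realize_imp, realize_hypB, realize_exN, realize_zeroB]
  constructor
  · intro h q B β δ ν hyp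
    have h' := h (valOf q B β δ ν)
    have e1 : qOf (valOf q B β δ ν) = q := funext fun i => valOf_qIdx q B β δ ν i
    have e2 : bOf (valOf q B β δ ν) = B := by ext i j; simp [bOf]
    rw [e1, e2, valOf_cIdx, valOf_cIdx, valOf_cIdx] at h'
    obtain ⟨ys, hys⟩ := h' (by simpa using hyp)
    exact ⟨fun j => Fin.append (valOf q B β δ ν) ys (xIdx j), hys⟩
  · intro h xs hyp
    obtain ⟨x, hx⟩ := h (qOf xs) (bOf xs) (xs (cIdx n 0)) (xs (cIdx n 1)) (xs (cIdx n 2)) hyp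
    refine ⟨x, fun i => ?_⟩
    have e : (fun j => Fin.append xs x (xIdx j)) = x := funext fun j => by simp [xIdx]
    rw [e]
    exact hx i

end Semantics

/-! ### The formal-derivative instance and its truth in `ℝ` -/

section RealBridge

variable {n : ℕ} (F : Fin n → Language.orderedExpRing.Term (Empty ⊕ Fin n))

/-- the Jacobian entries as formal partial derivatives: `G i j = ∂ⱼ Fᵢ` [cite: Wilkie1989, §1, p. 385] -/
def pdTerms : Fin n → Fin n → Language.orderedExpRing.Term (Empty ⊕ Fin n) :=
  fun i j => termPDeriv j (F i)

/-- the second formal partial derivatives: `H i j k = ∂ₖ ∂ⱼ Fᵢ` [cite: Wilkie1989, §1, p. 385] -/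
def pd2Terms : Fin n → Fin n → Fin n → Language.orderedExpRing.Term (Empty ⊕ Fin n) :=
  fun i j k => termPDeriv k (termPDeriv j (F i))

/-- Over `ℝ`, `jacM (pdTerms F) = jacFun F` (`NewtonExpSystems.lean`), by `rfl`. [folklore] -/
theorem jacM_pdTerms_real (q : Fin n → ℝ) : jacM (pdTerms F) q = jacFun F q := rfl

/-- `expM ℝ = Real.exp`. [folklore] -/
theorem expM_real : expM ℝ = Real.exp := rfl

/-- Over `ℝ`, `majEval Real.exp = majFun`. [folklore] -/
theorem majEval_real (ν : ℝ) : ∀ t : Language.orderedExpRing.Term (Empty ⊕ Fin n),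
    majEval Real.exp ν t = majFun ν t
  | var _ => rfl
  | func expRingFunc.add ts => by simp only [majEval, majFun, majEval_real ν (ts 0), majEval_real ν (ts 1)]
  | func expRingFunc.mul ts => by simp only [majEval, majFun, majEval_real ν (ts 0), majEval_real ν (ts 1)]
  | func expRingFunc.neg ts => by simp only [majEval, majFun, majEval_real ν (ts 0)]
  | func expRingFunc.zero _ => rfl
  | func expRingFunc.one _ => rfl
  | func expRingFunc.exp ts => by simp only [majEval, majFun, majEval_real ν (ts 0)]

/-- Over `ℝ`, `lipM (pd2Terms F) ν = lipschitzConst F ν`. [folklore] -/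
theorem lipM_pd2Terms_real (ν : ℝ) : lipM (pd2Terms F) ν = lipschitzConst F ν := by
  simp only [lipM, lipschitzConst, pd2Terms, expM_real, majEval_real]

/-- Over `ℝ`, the semantic hypothesis for the formal derivatives is the hypothesis list of
`NewtonExp.exists_zero_of_newtonHyp`; hence **`ℝ ⊨ NK_F`** for `G, H` the formal partial
derivatives. [cite: JonesServi2011, Lemma 3.5 (proof)] -/
theorem real_models_newtonSentence_pd : ℝ ⊨ newtonSentence F (pdTerms F) (pd2Terms F) := by
  rw [realize_newtonSentence_iff]
  intro q B β δ ν h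
  obtain ⟨x, -, hx, -⟩ := exists_zero_of_newtonHyp F h.hβ₀ h.hδ₀ h.hν₀ h.hB h.hβ h.hδ h.hν
    (by rw [← lipM_pd2Terms_real]; exact h.hsmall)
  exact ⟨x, fun i => congrFun hx i⟩

end RealBridge

end NewtonExp

end Literature.ModelTheory.ExponentialFields

end
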